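import Summits.CriticalPhenomena.PercolationContinuityZ3.Theorems.PercNearOneGluingNoHeavyLowerTailSunflowerCoverThree
import HarnessLib

/-!
# `NoHeavyLowerTail` (crux stmt-CriticalPhenomena-4575), abstract sunflower cubic: SAFETY FROM THE FINITE PARTITION TEST

Support file (seat `prim-ineq-prove-1` gen 37; `--supports stmt-CriticalPhenomena-4575`).  No `sorry`, no named facts.
Memo: run/shared/lean/prim/prim-ineq-prove-1/FINDING-TROPICAL-prove1-g37.md §1.

SETTING (as `…SunflowerSafeCalculus`, `…SunflowerLSMGraded`, `…SunflowerCoverThree`).  `μ = prodBernoulli p`, an up-set `A`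
determined by a block `a`, and a family `𝒯` of bad subsets of the block covering every bad missing set (e.g. the minimal
transversals of `A`); `famIn p a 𝒯 𝒰 = μ(ω meets every C ∈ 𝒯 ∖ 𝒰)` is the hitting function and `famIn p a 𝒯 ∅ = μ A`.
The definition `Safe p A` quantifies over ALL finite families of up-sets meeting pairwise inside `A`.  This file reduces it to
a FINITE test on `𝒯` (memo g34 §9, "SAFE ⟺ ∏ f(𝒰ᵢ) ≤ h^{K−1} for pairwise disjoint 𝒰ᵢ", so far used only informally):
* **`safe_of_disjoint_famIn`**: if `∏_k famIn (𝒰 k) ≤ (famIn ∅)^(n−1)` for every `n` and every `n`-tuple of pairwise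
  disjoint sub-families of `𝒯`, then `A` is safe (each up-set `V` lies in the hitting event of the members it does not give
  up, `{C ∈ 𝒯 | (↑C)ᶜ ∈ V}`, and up-sets meeting inside `A` give up disjoint families);
* **`disjoint_famIn_of_nonempty`**: when `famIn ∅ > 0` it is enough to test tuples of NONEMPTY pairwise disjoint
  sub-families, hence only `k ≤ #𝒯` of them (the empty members contribute the factor `famIn ∅` exactly);
* `famIn_two_le` — for two disjoint sub-families the test is Harris (`famIn_mul_le_inter`), so only `3 ≤ k ≤ #𝒯` is ever
  checked numerically.
Used by `…SunflowerCoverCounterexample` (the four-point core refuting `CoverOfSafe`).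
-/

noncomputable section

namespace Summit.CriticalPhenomena.PercolationContinuityZ3.Theorems.SunflowerPartition

namespace SafeCalc

open MeasureTheory Finset
open Literature.Probability.LatticeModels Literature.Probability.Percolation

variable {ι : Type*} [DecidableEq ι] (p : ι → unitInterval) (a : Finset ι)

/-! ## Safety from the finite partition test -/

/-- **Safety from the disjoint-families test.**  If `∏_k famIn p a 𝒯 (𝒰 k) ≤ (famIn p a 𝒯 ∅)^(n−1)` for every tuple of pairwise
disjoint sub-families of `𝒯`, then the up-set `A` (determined by the block `a`, every member of `𝒯` bad, `𝒯` covering the bad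
missing sets) is SAFE. [this work] -/
theorem safe_of_disjoint_famIn [Fintype ι] {A : Set (Set ι)} (hd : DeterminedBy A (↑a : Set ι)) (hu : IsUpperSet A)
    (𝒯 : Finset (Finset ι)) (h𝒯a : ∀ C ∈ 𝒯, C ⊆ a) (hbad : ∀ C ∈ 𝒯, ((a \ C : Finset ι) : Set ι) ∉ A)
    (hcov : ∀ T, T ⊆ a → ((a \ T : Finset ι) : Set ι) ∉ A → ∃ C ∈ 𝒯, C ⊆ T)
    (H0 : ∀ (n : ℕ) (𝒰 : Fin n → Finset (Finset ι)), (∀ k, 𝒰 k ⊆ 𝒯) → (∀ k l, k ≠ l → Disjoint (𝒰 k) (𝒰 l)) →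
      ∏ k, famIn p a 𝒯 (𝒰 k) ≤ famIn p a 𝒯 ∅ ^ (n - 1)) :
    Safe p A := by
  classical
  intro n V hV hcap
  have hbad' : ∀ C ∈ 𝒯, ∀ T, T ⊆ a → C ⊆ T → ((a \ T : Finset ι) : Set ι) ∉ A := by
    intro C hC T _ hCT hTA
    refine hbad C hC (hu ?_ hTA)
    exact Finset.coe_subset.2 (Finset.sdiff_subset_sdiff (subset_refl a) hCT)
  have hh : famIn p a 𝒯 ∅ = (prodBernoulli p).real A := famIn_empty p a hd 𝒯 hbad' hcov
  rw [← hh]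
  -- the members each event gives up: `𝒰 k = {C ∈ 𝒯 | (↑C)ᶜ ∈ V k}`
  let 𝒰 : Fin n → Finset (Finset ι) := fun k => 𝒯.filter fun C => ((↑C : Set ι)ᶜ) ∈ V k
  have hmem : ∀ k C, C ∈ 𝒰 k ↔ C ∈ 𝒯 ∧ ((↑C : Set ι)ᶜ) ∈ V k := fun k C => by
    simp only [𝒰, mem_filter]
  -- an up-set lies in the hitting event of the members it does not give up
  have hsub : ∀ k, V k ⊆ hitSet 𝒯 (𝒰 k) := by
    intro k ω hω C hC hCd
    by_contra hne
    push Not at hne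
    refine hCd ((hmem k C).2 ⟨hC, hV k ?_ hω⟩)
    intro e he heC
    exact hne e heC he
  -- events meeting inside `A` give up disjoint families
  have hdisj : ∀ k l, k ≠ l → Disjoint (𝒰 k) (𝒰 l) := by
    intro k l hkl
    rw [Finset.disjoint_left]
    intro C hCV hCW
    rw [hmem] at hCV hCW
    have hA : ((↑C : Set ι)ᶜ) ∈ A := hcap k l hkl ⟨hCV.2, hCW.2⟩
    have key : ((↑C : Set ι)ᶜ) ∩ (↑a : Set ι) = ((a \ C : Finset ι) : Set ι) ∩ (↑a : Set ι) := by
      ext e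
      simp only [Set.mem_inter_iff, Set.mem_compl_iff, Finset.mem_coe, Finset.mem_sdiff]
      tauto
    exact hbad C hCV.1 (((determinedBy_iff A _).1 hd _ _ key).1 hA)
  have h1 : ∀ k, (prodBernoulli p).real (V k) ≤ famIn p a 𝒯 (𝒰 k) := fun k => by
    rw [famIn_eq_real_hitSet p a h𝒯a]
    exact measureReal_mono (hsub k)
  calc ∏ k, (prodBernoulli p).real (V k) ≤ ∏ k, famIn p a 𝒯 (𝒰 k) :=
        prod_le_prod (fun k _ => measureReal_nonneg) fun k _ => h1 k
    _ ≤ famIn p a 𝒯 ∅ ^ (n - 1) := H0 n 𝒰 (fun k => filter_subset _ _) hdisj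

/-- **Reduction to nonempty members.**  If `famIn p a 𝒯 ∅ > 0` and the disjoint-families test holds for all tuples of at most
`#𝒯` NONEMPTY pairwise disjoint sub-families, it holds for all tuples (empty members contribute the factor `famIn ∅`). [this work] -/
theorem disjoint_famIn_of_nonempty (𝒯 : Finset (Finset ι)) (hh : 0 < famIn p a 𝒯 ∅)
    (HF : ∀ (k : ℕ), k ≤ 𝒯.card → ∀ (𝒰 : Fin k → Finset (Finset ι)), (∀ i, 𝒰 i ⊆ 𝒯) → (∀ i, (𝒰 i).Nonempty) →
      (∀ i j, i ≠ j → Disjoint (𝒰 i) (𝒰 j)) → ∏ i, famIn p a 𝒯 (𝒰 i) ≤ famIn p a 𝒯 ∅ ^ (k - 1)) :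
    ∀ (n : ℕ) (𝒰 : Fin n → Finset (Finset ι)), (∀ k, 𝒰 k ⊆ 𝒯) → (∀ k l, k ≠ l → Disjoint (𝒰 k) (𝒰 l)) →
      ∏ k, famIn p a 𝒯 (𝒰 k) ≤ famIn p a 𝒯 ∅ ^ (n - 1) := by
  classical
  intro n 𝒰 hsub hdisj
  set h := famIn p a 𝒯 ∅ with hdef
  have hh1 : h ≤ 1 := famIn_le_one p a 𝒯 ∅
  set J : Finset (Fin n) := univ.filter fun k => (𝒰 k).Nonempty with hJ
  have hJmem : ∀ k, k ∈ J ↔ (𝒰 k).Nonempty := fun k => by rw [hJ, mem_filter]; simp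
  -- the empty members contribute `h` each
  have hempty : ∀ k, k ∉ J → famIn p a 𝒯 (𝒰 k) = h := by
    intro k hk
    rw [hJmem, Finset.not_nonempty_iff_eq_empty] at hk
    rw [hk]
  have hsplit : ∏ k, famIn p a 𝒯 (𝒰 k) = (∏ k ∈ J, famIn p a 𝒯 (𝒰 k)) * h ^ (n - J.card) := by
    rw [← prod_filter_mul_prod_filter_not univ (fun k => (𝒰 k).Nonempty)]
    congr 1
    have hc : (univ.filter fun k => ¬(𝒰 k).Nonempty).card = n - J.card := by
      have := Finset.card_filter_add_card_filter_not (s := (univ : Finset (Fin n)))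
        (fun k => (𝒰 k).Nonempty)
      rw [card_univ, Fintype.card_fin] at this
      rw [← hJ] at this
      omega
    rw [← hc, ← prod_const]
    refine prod_congr rfl fun k hk => hempty k ?_
    rw [mem_filter] at hk
    rw [hJmem]; exact hk.2
  -- at most `#𝒯` nonempty members
  have hJcard : J.card ≤ 𝒯.card := by
    have hdisjJ : (↑J : Set (Fin n)).PairwiseDisjoint 𝒰 := fun k _ l _ hkl => hdisj k l hkl
    calc J.card = ∑ k ∈ J, 1 := by rw [sum_const, smul_eq_mul, mul_one]
      _ ≤ ∑ k ∈ J, (𝒰 k).card := sum_le_sum fun k hk => ((hJmem k).1 hk).card_pos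
      _ = (J.biUnion 𝒰).card := (card_biUnion hdisjJ).symm
      _ ≤ 𝒯.card := card_le_card (biUnion_subset.2 fun k _ => hsub k)
  -- reindex the nonempty members by `Fin J.card` and apply the hypothesis
  have hmain : ∏ k ∈ J, famIn p a 𝒯 (𝒰 k) ≤ h ^ (J.card - 1) := by
    let e := J.equivFin
    have hre : ∏ i : Fin J.card, famIn p a 𝒯 (𝒰 (e.symm i)) = ∏ k ∈ J, famIn p a 𝒯 (𝒰 k) := by
      rw [Fintype.prod_equiv e.symm (fun i => famIn p a 𝒯 (𝒰 (e.symm i))) (fun k : ↥J => famIn p a 𝒯 (𝒰 k))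
        (fun _ => rfl), ← Finset.prod_attach J, Finset.attach_eq_univ]
    rw [← hre]
    refine HF J.card hJcard (fun i => 𝒰 (e.symm i)) (fun i => hsub _) (fun i => (hJmem _).1 (e.symm i).2)
      fun i j hij => hdisj _ _ fun heq => hij (e.symm.injective (Subtype.ext heq))
  rw [hsplit]
  calc (∏ k ∈ J, famIn p a 𝒯 (𝒰 k)) * h ^ (n - J.card) ≤ h ^ (J.card - 1) * h ^ (n - J.card) :=
        mul_le_mul_of_nonneg_right hmain (pow_nonneg hh.le _)
    _ = h ^ (J.card - 1 + (n - J.card)) := (pow_add _ _ _).symm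
    _ ≤ h ^ (n - 1) := by
        refine pow_le_pow_of_le_one hh.le hh1 ?_
        have : J.card ≤ n := by simpa using card_le_univ J
        omega

/-- For TWO disjoint sub-families the test is Harris. [this work] -/
theorem famIn_two_le [Fintype ι] {𝒯 : Finset (Finset ι)} (h𝒯a : ∀ C ∈ 𝒯, C ⊆ a) {𝒰 𝒱 : Finset (Finset ι)}
    (hUV : Disjoint 𝒰 𝒱) : famIn p a 𝒯 𝒰 * famIn p a 𝒯 𝒱 ≤ famIn p a 𝒯 ∅ := by
  have h := famIn_mul_le_inter p a h𝒯a 𝒰 𝒱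
  rwa [Finset.disjoint_iff_inter_eq_empty.1 hUV] at h

end SafeCalc

end Summit.CriticalPhenomena.PercolationContinuityZ3.Theorems.SunflowerPartition
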